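import Mathlib.Analysis.Calculus.MeanValue
import Mathlib.Topology.UniformSpace.HeineCantor
import Literature.Analysis.FunctionSpaces.TorusConvolution
import Literature.Analysis.FunctionSpaces.TorusSpaceTime
import Literature.Analysis.FunctionSpaces.TorusCalculusProofs
import HarnessLib

/-!
# Space convolution of jointly smooth space–time fields: joint smoothness within convex time sets

Analysis/FunctionSpaces support file. For an integrable kernel `θ ∈ L¹(T^d)` and a field
`g : ℝ → T^d → F` that is jointly smooth on `S × T^d` (`Torus.IsSmoothSpaceTimeOn S g`:
the space–time lift is `C^∞` on `S ×ˢ univ`, one-sided in time at the endpoints of `S`), the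
slice-wise mollification `t ↦ θ ⋆ g t` (Mathlib's group convolution on the compact abelian group
`T^d`, `(θ ⋆ k)(x) = ∫ θ(y) k(x - y) dy`) is again jointly smooth on `S × T^d`
(`Torus.IsSmoothSpaceTimeOn.convolution`, `S` convex with nonempty interior, e.g. `[0, T]`,
`[0, ∞)`). This is the parametric form of Evans, App. C.4, Thm. 7 (i) ("`D^α(η_ε ⋆ f) = η_ε ⋆ D^α f`",
all derivatives falling on the smooth factor) that is needed whenever a Fourier multiplier of
negative order — written as a convolution with an integrable kernel, e.g. the inverse Laplacian
of `TorusInverseLaplacian` — is applied to a time-dependent smooth field and the result has to be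
a *classical* space–time object up to the initial/final time (Cheskidov–Luo 2022, §2.6: the
Reynolds stress `R₀ = ℛ(∂ₜu₀ - Δu₀ + div(u₀ ⊗ u₀))` of the first iterate is smooth on `[0,T] × 𝕋^d`).

The only analytic point is that the time set is **not open**: Mathlib differentiates under the
integral sign at interior points only (`hasFDerivAt_integral_of_dominated_of_fderiv_le`, over a
ball). Here:

* `hasFDerivWithinAt_integral_of_norm_sub_le` — abstract differentiation under `∫` *within a
  set*, from a uniform first-order remainder estimate `‖H x a - H x₀ a - H' a (x - x₀)‖ ≤
  ε · bound a · ‖x - x₀‖` eventually along `𝓝[s] x₀`;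
* `Torus.stDeriv S u` — the space–time derivative of `u` within `S` as a field of continuous
  linear maps `ℝ × ℝ^d →L F`, `(a, v) ↦ a • ∂ₜ^S u + D(u t) v`; for jointly smooth `u` it IS the
  `fderivWithin` of the lift on `S ×ˢ univ` (`IsSmoothSpaceTimeOn.fderivWithin_stLift`) and is
  itself jointly smooth (`IsSmoothSpaceTimeOn.stDeriv`);
* `Torus.hasFDerivWithinAt_stLift_convolution` — on `S = [a, b]`:
  `D_{S × ℝ^d} (stLift (t ↦ θ ⋆ g t)) = stLift (t ↦ θ ⋆ stDeriv S g t)` (mean value inequality on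
  the convex sets `(S ×ˢ univ) ∩ ball`, Mathlib's
  `Convex.norm_image_sub_le_of_norm_hasFDerivWithin_le'`, with the uniform continuity of the
  derivative of the lift on the compact `[a, b] × closedBall`, Heine–Cantor);
* `Torus.contDiffOn_stLift_convolution`, `Torus.isSmoothSpaceTimeOn_convolution_Icc` — induction on
  the order through Mathlib's `contDiffOn_succ_iff_fderiv_apply` (the derivative in a fixed
  direction `p` is the mollification of the jointly smooth field `stDeriv S g · · p`), and the general
  convex case `Torus.IsSmoothSpaceTimeOn.convolution` by localisation
  (`exists_Icc_subset_mem_nhdsWithin_of_convex`); the time derivative formula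
  `Torus.timeDerivWithin_convolution_Icc` (`∂ₜ(θ ⋆ g) = θ ⋆ ∂ₜg`).

Slice-wise (fixed `t`) smoothness and the formulas `∂ᵢ(θ ⋆ k) = θ ⋆ ∂ᵢk`, `Δ(θ ⋆ k) = θ ⋆ Δk` are
in `TorusConvolution` (`Torus.isSmooth_convolution`, …) and are not repeated.

## Mathlib search

Mathlib (this pin) has `hasFDerivAt_integral_of_dominated_of_fderiv_le` (ball version only; no
`HasFDerivWithinAt` variant: searched `hasFDerivWithinAt_integral`, none), the mean value
inequality on convex sets with `HasFDerivWithinAt` (`Convex.norm_image_sub_le_of_norm_hasFDerivWithin_le'`),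
Heine–Cantor on compact sets (`IsCompact.uniformContinuousOn_of_continuous`) and
`contDiffOn_succ_iff_fderiv_apply`; these are combined here. (The Bochner integral needs no
completeness hypothesis: Mathlib assigns the junk value `0` in incomplete codomains, and all
statements here remain true verbatim.)

## References

* L. C. Evans, *Partial Differential Equations*, 2nd ed., GSM 19 (AMS 2010), App. C.4, Thm. 7 (i)
  (derivatives of mollifications). [`Evans2010`]
* A. Cheskidov, X. Luo, *Sharp nonuniqueness for the Navier–Stokes equations*, Invent. Math. 229
  (2022) = arXiv:2009.06596, §2.6 and App. B (§7.2) (consumer). [`CheskidovLuo2022`]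
-/

noncomputable section

open MeasureTheory Set Filter Metric Function Topology
open scoped Convolution ContDiff

namespace Literature.Analysis.FunctionSpaces

/-! ## Differentiation under the integral sign within a set -/

section Abstract

variable {α : Type*} [MeasurableSpace α] {μ : Measure α}
  {E : Type*} [NormedAddCommGroup E] [NormedSpace ℝ E]
  {F : Type*} [NormedAddCommGroup F] [NormedSpace ℝ F]

/-- **Differentiation under the integral sign within a set, from a uniform remainder estimate.**
Let `H : E → α → F` have integrable slices `H x` for `x ∈ insert x₀ s`, let `H' : α → (E →L F)`
and `bound : α → ℝ` be integrable, and suppose that for every `ε > 0`, eventually as `x → x₀`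
within `s`, `‖H x a - H x₀ a - H' a (x - x₀)‖ ≤ ε · bound a · ‖x - x₀‖` for all `a`. Then
`x ↦ ∫ H x a dμ` has derivative `∫ H' a dμ` at `x₀` within `s` (integrate the estimate:
the remainder of the integral is at most `ε ‖bound‖₁ ‖x - x₀‖`). This is the one-sided /
within-a-set companion of Mathlib's `hasFDerivAt_integral_of_dominated_of_fderiv_le`. [folklore] -/
theorem hasFDerivWithinAt_integral_of_norm_sub_le {s : Set E} {x₀ : E} {H : E → α → F}
    {H' : α → E →L[ℝ] F} {bound : α → ℝ}
    (hH : ∀ x ∈ insert x₀ s, Integrable (H x) μ) (hH' : Integrable H' μ)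
    (hbound : Integrable bound μ)
    (h : ∀ ε : ℝ, 0 < ε → ∀ᶠ x in 𝓝[s] x₀, ∀ a,
      ‖H x a - H x₀ a - H' a (x - x₀)‖ ≤ ε * bound a * ‖x - x₀‖) :
    HasFDerivWithinAt (fun x => ∫ a, H x a ∂μ) (∫ a, H' a ∂μ) s x₀ := by
  rw [hasFDerivWithinAt_iff_isLittleO, Asymptotics.isLittleO_iff]
  intro c hc
  set B : ℝ := ∫ a, ‖bound a‖ ∂μ with hB_def
  have hB0 : 0 ≤ B := integral_nonneg fun a => norm_nonneg _
  have hε : 0 < c / (B + 1) := div_pos hc (by linarith)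
  filter_upwards [h _ hε, self_mem_nhdsWithin] with x hx hxs
  have hx₀ : Integrable (H x₀) μ := hH x₀ (mem_insert _ _)
  have hxI : Integrable (H x) μ := hH x (mem_insert_of_mem _ hxs)
  have hL : Integrable (fun a => H' a (x - x₀)) μ := hH'.apply_continuousLinearMap _
  have h1 : (∫ a, H x a ∂μ) - (∫ a, H x₀ a ∂μ) - (∫ a, H' a ∂μ) (x - x₀) =
      ∫ a, (H x a - H x₀ a - H' a (x - x₀)) ∂μ := by
    have e1 : ∫ a, (H x a - H x₀ a - H' a (x - x₀)) ∂μ =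
        (∫ a, (H x a - H x₀ a) ∂μ) - ∫ a, H' a (x - x₀) ∂μ := integral_sub (hxI.sub' hx₀) hL
    have e2 : ∫ a, (H x a - H x₀ a) ∂μ = (∫ a, H x a ∂μ) - ∫ a, H x₀ a ∂μ := integral_sub hxI hx₀
    rw [e1, e2, ContinuousLinearMap.integral_apply hH']
  rw [h1]
  have hint : ∫ a, bound a ∂μ ≤ B := (Real.le_norm_self _).trans (norm_integral_le_integral_norm _)
  have hcB : c / (B + 1) * ∫ a, bound a ∂μ ≤ c := by
    calc c / (B + 1) * ∫ a, bound a ∂μ ≤ c / (B + 1) * B :=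
          mul_le_mul_of_nonneg_left hint hε.le
      _ ≤ c := by
          rw [div_mul_eq_mul_div, div_le_iff₀ (by linarith)]
          nlinarith
  calc ‖∫ a, (H x a - H x₀ a - H' a (x - x₀)) ∂μ‖
      ≤ ∫ a, c / (B + 1) * bound a * ‖x - x₀‖ ∂μ :=
        norm_integral_le_of_norm_le ((hbound.const_mul _).mul_const _) (Eventually.of_forall hx)
    _ = c / (B + 1) * (∫ a, bound a ∂μ) * ‖x - x₀‖ := by
        rw [integral_mul_const, integral_const_mul]
    _ ≤ c * ‖x - x₀‖ := mul_le_mul_of_nonneg_right hcB (norm_nonneg _)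

end Abstract

namespace Torus

variable {d : Type*} [Fintype d]

/-! ## The space–time derivative field within a time set -/

section StDeriv

variable {F : Type*} [NormedAddCommGroup F] [NormedSpace ℝ F]
variable {S : Set ℝ} {u : ℝ → UnitAddTorus d → F}

/-- The space–time derivative of `u : ℝ → T^d → F` within the time set `S` at `(t, x)`, as a
continuous linear map `ℝ × ℝ^d →L F`: `(a, v) ↦ a • ∂ₜ^S u (t, x) + D(u t)(x) v`, built from the
one-sided time derivative `Torus.timeDerivWithin S` and the spatial Fréchet derivative
`Torus.fderiv` of the slice. For jointly smooth `u` on a time set of unique differentiability it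
is the Fréchet derivative of the space–time lift within `S ×ˢ univ`
(`IsSmoothSpaceTimeOn.fderivWithin_stLift`). [folklore] -/
def stDeriv (S : Set ℝ) (u : ℝ → UnitAddTorus d → F) (t : ℝ) (x : UnitAddTorus d) :
    ℝ × EuclideanSpace ℝ d →L[ℝ] F :=
  (ContinuousLinearMap.fst ℝ ℝ (EuclideanSpace ℝ d)).smulRight (timeDerivWithin S u t x) +
    (Torus.fderiv (u t) x).comp (ContinuousLinearMap.snd ℝ ℝ (EuclideanSpace ℝ d))

omit [Fintype d] in
/-- `stDeriv S u t x (a, v) = a • ∂ₜ^S u (t, x) + D(u t)(x) v`. [folklore] -/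
@[simp]
theorem stDeriv_apply (S : Set ℝ) (u : ℝ → UnitAddTorus d → F) (t : ℝ) (x : UnitAddTorus d)
    (a : ℝ) (v : EuclideanSpace ℝ d) :
    stDeriv S u t x (a, v) = a • timeDerivWithin S u t x + Torus.fderiv (u t) x v := by
  simp [stDeriv]

/-- For a jointly smooth field on a time set of unique differentiability, the Fréchet derivative
of the space–time lift within `S ×ˢ univ` is the lift of `stDeriv S u`
(`IsSmoothSpaceTimeOn.timeDerivWithin_apply_proj` in the direction `(1, 0)` and
`IsSmoothSpaceTimeOn.fderiv_slice_apply` in the directions `(0, v)`). [folklore] -/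
theorem IsSmoothSpaceTimeOn.fderivWithin_stLift (hu : IsSmoothSpaceTimeOn S u)
    (hS : UniqueDiffOn ℝ S) {t : ℝ} (ht : t ∈ S) (y : EuclideanSpace ℝ d) :
    fderivWithin ℝ (stLift u) (S ×ˢ univ) (t, y) = stDeriv S u t (proj y) := by
  refine ContinuousLinearMap.ext fun p => ?_
  obtain ⟨a, v⟩ := p
  have h : ((a, v) : ℝ × EuclideanSpace ℝ d) =
      a • ((1 : ℝ), (0 : EuclideanSpace ℝ d)) + ((0 : ℝ), v) := by
    ext <;> simp
  conv_lhs => rw [h]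
  rw [map_add, map_smul, stDeriv_apply, hu.timeDerivWithin_apply_proj hS ht y,
    hu.fderiv_slice_apply ht y v]

/-- A jointly smooth field on a time set of unique differentiability has `stDeriv S u` as
Fréchet derivative of its lift within `S ×ˢ univ`, at every point of that set. [folklore] -/
theorem IsSmoothSpaceTimeOn.hasFDerivWithinAt_stLift (hu : IsSmoothSpaceTimeOn S u)
    (hS : UniqueDiffOn ℝ S) {t : ℝ} (ht : t ∈ S) (y : EuclideanSpace ℝ d) :
    HasFDerivWithinAt (stLift u) (stDeriv S u t (proj y)) (S ×ˢ univ) (t, y) := by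
  rw [← hu.fderivWithin_stLift hS ht y]
  exact (hu.differentiableOn (by simp) (t, y) ⟨ht, mem_univ _⟩).hasFDerivWithinAt

/-- **The space–time derivative field of a jointly smooth field is jointly smooth** (on time sets
of unique differentiability): its lift agrees with `fderivWithin` of the lift on `S ×ˢ univ`,
which is `C^∞` there by Mathlib's `ContDiffOn.fderivWithin`. [folklore] -/
theorem IsSmoothSpaceTimeOn.stDeriv (hu : IsSmoothSpaceTimeOn S u) (hS : UniqueDiffOn ℝ S) :
    IsSmoothSpaceTimeOn S (stDeriv S u) := by
  have hU : UniqueDiffOn ℝ (S ×ˢ (univ : Set (EuclideanSpace ℝ d))) := hS.prod uniqueDiffOn_univ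
  refine (hu.fderivWithin hU le_rfl).congr fun z hz => ?_
  obtain ⟨t, y⟩ := z
  exact (hu.fderivWithin_stLift hS (mem_prod.1 hz).1 y).symm

omit [Fintype d] in
/-- In the time direction, `stDeriv S u t x (1, 0) = ∂ₜ^S u (t, x)`. [folklore] -/
theorem stDeriv_apply_one_zero (S : Set ℝ) (u : ℝ → UnitAddTorus d → F) (t : ℝ) (x : UnitAddTorus d) :
    stDeriv S u t x (1, 0) = timeDerivWithin S u t x := by
  simp [stDeriv]

end StDeriv

/-! ## Auxiliary: the centred representative is bounded; compact intervals inside convex time sets -/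

section Aux

/-- The centred representative `reprc z ∈ [-1/2, 1/2)^d` has Euclidean norm at most
`(∑ᵢ (1/2)²)^{1/2}`. [folklore] -/
theorem exists_norm_reprc_le : ∃ R : ℝ, 0 ≤ R ∧ ∀ z : UnitAddTorus d, ‖reprc z‖ ≤ R := by
  refine ⟨Real.sqrt (∑ _i : d, ((1 : ℝ) / 2) ^ 2), Real.sqrt_nonneg _, fun z => ?_⟩
  rw [EuclideanSpace.norm_eq]
  refine Real.sqrt_le_sqrt (Finset.sum_le_sum fun i _ => ?_)
  rw [Real.norm_eq_abs]
  exact pow_le_pow_left₀ (abs_nonneg _) (abs_reprc_apply_le z i) 2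

omit [Fintype d] in
/-- **Localisation in time.** In a convex time set `S ⊆ ℝ` with nonempty interior, every point
`t₀ ∈ S` has a neighbourhood within `S` which is a non-degenerate compact interval
`[a, b] ⊆ S`. [folklore] -/
theorem exists_Icc_subset_mem_nhdsWithin_of_convex {S : Set ℝ} (hS : Convex ℝ S)
    (hSi : (interior S).Nonempty) {t₀ : ℝ} (ht₀ : t₀ ∈ S) :
    ∃ a b : ℝ, a < b ∧ Icc a b ⊆ S ∧ Icc a b ∈ 𝓝[S] t₀ := by
  have hOC : S.OrdConnected := hS.ordConnected
  by_cases hint : t₀ ∈ interior S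
  · -- interior point: a closed ball around `t₀`
    obtain ⟨r, hr, hball⟩ := Metric.mem_nhds_iff.1 (mem_interior_iff_mem_nhds.1 hint)
    refine ⟨t₀ - r / 2, t₀ + r / 2, by linarith, fun s hs => ?_, ?_⟩
    · refine hball ?_
      rw [Metric.mem_ball, Real.dist_eq, abs_lt]
      constructor <;> linarith [hs.1, hs.2]
    · exact mem_nhdsWithin_of_mem_nhds (Icc_mem_nhds (by linarith) (by linarith))
  · -- boundary point: use an interior point `c ≠ t₀`
    obtain ⟨c, hc⟩ := hSi
    have hcS : c ∈ S := interior_subset hc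
    have hct : c ≠ t₀ := fun h => hint (h ▸ hc)
    rcases lt_or_gt_of_ne hct with hlt | hgt
    · -- `c < t₀`: no point of `S` lies above `t₀`
      have habove : ∀ s ∈ S, s ≤ t₀ := by
        intro s hs
        by_contra h
        have h' : t₀ < s := not_le.mp h
        have hI : Icc c s ⊆ S := hOC.out hcS hs
        exact hint (interior_mono hI (by rw [interior_Icc]; exact ⟨hlt, h'⟩))
      refine ⟨c, t₀, hlt, hOC.out hcS ht₀, ?_⟩
      have h1 : S ∩ Ioi c ⊆ Icc c t₀ := fun s hs => ⟨le_of_lt hs.2, habove s hs.1⟩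
      exact mem_of_superset (inter_mem_nhdsWithin S (Ioi_mem_nhds hlt)) h1
    · -- `t₀ < c`: no point of `S` lies below `t₀`
      have hbelow : ∀ s ∈ S, t₀ ≤ s := by
        intro s hs
        by_contra h
        have h' : s < t₀ := not_le.mp h
        have hI : Icc s c ⊆ S := hOC.out hs hcS
        exact hint (interior_mono hI (by rw [interior_Icc]; exact ⟨h', hgt⟩))
      refine ⟨t₀, c, hgt, hOC.out ht₀ hcS, ?_⟩
      have h1 : S ∩ Iio c ⊆ Icc t₀ c := fun s hs => ⟨hbelow s hs.1, le_of_lt hs.2⟩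
      exact mem_of_superset (inter_mem_nhdsWithin S (Iio_mem_nhds hgt)) h1

end Aux

/-! ## Space convolution of jointly smooth fields -/

section Convolution

open ContinuousLinearMap

variable {F : Type*} [NormedAddCommGroup F] [NormedSpace ℝ F]
variable {θ : UnitAddTorus d → ℝ} {a b : ℝ}

/-- Evaluation commutes with operator-valued mollification, for continuous kernels with values in
`E' →L F` (`TorusConvolution`'s `Torus.convolution_clm_apply` is the case `E' = ℝ^d`):
`(θ ⋆ K)(x) v = (θ ⋆ (K · v))(x)`. [folklore] -/
theorem convolution_clm_apply' {E' : Type*} [NormedAddCommGroup E'] [NormedSpace ℝ E']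
    (hθ : Integrable θ volume) {K : UnitAddTorus d → E' →L[ℝ] F} (hK : Continuous K)
    (x : UnitAddTorus d) (v : E') : (θ ⋆ K) x v = (θ ⋆ fun y => K y v) x := by
  rw [convolution_lsmul, convolution_lsmul,
    ContinuousLinearMap.integral_apply (integrable_smul_comp_sub hθ hK x)]
  simp

/-- The space–time lift of the slice-wise mollification through the centred fundamental domain:
`stLift (t ↦ θ ⋆ g t) z = ∫ θ y • stLift g (z - (0, reprc y)) dy`. [folklore] -/
theorem stLift_convolution_eq (θ : UnitAddTorus d → ℝ) (g : ℝ → UnitAddTorus d → F)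
    (z : ℝ × EuclideanSpace ℝ d) :
    stLift (fun t => θ ⋆ g t) z =
      ∫ y, θ y • stLift g (z - ((0 : ℝ), reprc y)) := by
  obtain ⟨t, x⟩ := z
  simp only [stLift_apply, Prod.mk_sub_mk, sub_zero, convolution_lsmul, proj_sub, proj_reprc]

/-- **Differentiation under the integral sign, within `[a, b] × ℝ^d`.** For `θ ∈ L¹(T^d)` and
`g` jointly smooth on `[a, b] × T^d` (`a < b`), the lift of `t ↦ θ ⋆ g t` has, within
`[a, b] ×ˢ univ` and at each of its points, the Fréchet derivative
`stLift (t ↦ θ ⋆ stDeriv [a,b] g t)` — all derivatives fall on `g` (Evans, App. C.4, Thm. 7 (i),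
one-sided in time at `t = a, b`). Proof: the derivative `D` of the lift of `g` within
`[a,b] ×ˢ univ` is continuous, hence uniformly continuous on the compact
`[a, b] × closedBall x₀ (1 + sup ‖reprc‖)`; the mean value inequality on the convex sets
`([a,b] ×ˢ univ) ∩ ball z₀ δ` then gives the first-order remainder estimate uniformly in the
integration variable, and `hasFDerivWithinAt_integral_of_norm_sub_le` applies. [folklore] -/
theorem hasFDerivWithinAt_stLift_convolution (hθ : Integrable θ volume)
    {g : ℝ → UnitAddTorus d → F} (hg : IsSmoothSpaceTimeOn (Icc a b) g) (hab : a < b)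
    {z₀ : ℝ × EuclideanSpace ℝ d} (hz₀ : z₀ ∈ Icc a b ×ˢ (univ : Set (EuclideanSpace ℝ d))) :
    HasFDerivWithinAt (stLift fun t => θ ⋆ g t)
      (stLift (fun t => θ ⋆ stDeriv (Icc a b) g t) z₀) (Icc a b ×ˢ univ) z₀ := by
  set S : Set ℝ := Icc a b with hS_def
  set S' : Set (ℝ × EuclideanSpace ℝ d) := S ×ˢ univ with hS'_def
  have hS : UniqueDiffOn ℝ S := uniqueDiffOn_Icc hab
  obtain ⟨t₀, x₀⟩ := z₀
  have ht₀ : t₀ ∈ S := (mem_prod.1 hz₀).1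
  set G : ℝ × EuclideanSpace ℝ d → F := stLift g with hG_def
  set G' : ℝ × EuclideanSpace ℝ d → (ℝ × EuclideanSpace ℝ d →L[ℝ] F) :=
    stLift (stDeriv S g) with hG'_def
  have hG'c : ContinuousOn G' S' := (hg.stDeriv hS).continuousOn_stLift
  have hGd : ∀ z ∈ S', HasFDerivWithinAt G (G' z) S' z := by
    rintro ⟨t, y⟩ hz
    exact hg.hasFDerivWithinAt_stLift hS (mem_prod.1 hz).1 y
  -- the function and the claimed derivative as parametric integrals
  have hfun : (stLift fun t => θ ⋆ g t) =
      fun z => ∫ y, θ y • G (z - ((0 : ℝ), reprc y)) :=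
    funext fun z => stLift_convolution_eq θ g z
  rw [hfun, show stLift (fun t => θ ⋆ stDeriv S g t) (t₀, x₀) =
      ∫ y, θ y • G' ((t₀, x₀) - ((0 : ℝ), reprc y)) from stLift_convolution_eq θ (stDeriv S g) _]
  -- a bound on the centred representatives and the compact set carrying uniform continuity
  obtain ⟨R, hR0, hR⟩ := exists_norm_reprc_le (d := d)
  set Kc : Set (ℝ × EuclideanSpace ℝ d) := S ×ˢ closedBall x₀ (1 + R) with hKc_def
  have hKc : IsCompact Kc := isCompact_Icc.prod (isCompact_closedBall _ _)
  have hKS : Kc ⊆ S' := prod_mono Subset.rfl (subset_univ _)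
  have hUC : UniformContinuousOn G' Kc := hKc.uniformContinuousOn_of_continuous (hG'c.mono hKS)
  -- membership bookkeeping for translates `w - (0, reprc y)`
  have hsub1 : ∀ (w : ℝ × EuclideanSpace ℝ d) (y : UnitAddTorus d),
      (w - ((0 : ℝ), reprc y)).1 = w.1 := fun w y => by simp
  have hsub2 : ∀ (w : ℝ × EuclideanSpace ℝ d) (y : UnitAddTorus d),
      (w - ((0 : ℝ), reprc y)).2 = w.2 - reprc y := fun w y => by simp
  have hmemS' : ∀ {w : ℝ × EuclideanSpace ℝ d} (y : UnitAddTorus d), w ∈ S' →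
      w - ((0 : ℝ), reprc y) ∈ S' := fun y hw =>
    ⟨by rw [hsub1]; exact (mem_prod.1 hw).1, mem_univ _⟩
  refine hasFDerivWithinAt_integral_of_norm_sub_le (bound := fun y => ‖θ y‖) ?_ ?_ hθ.norm ?_
  · -- integrability of the slices
    intro z hz
    have hz' : z ∈ S' := by
      rcases hz with h | h
      · rw [h]; exact hz₀
      · exact h
    have hc : Continuous (g z.1) := (hg.isSmooth_slice (mem_prod.1 hz').1).continuous
    have hi := integrable_smul_comp_sub hθ hc (proj z.2)
    refine hi.congr (Eventually.of_forall fun y => ?_)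
    obtain ⟨t, x⟩ := z
    simp [hG_def, proj_sub]
  · -- integrability of the derivative slice
    have hc : Continuous (stDeriv S g t₀) := ((hg.stDeriv hS).isSmooth_slice ht₀).continuous
    have hi := integrable_smul_comp_sub hθ hc (proj x₀)
    refine hi.congr (Eventually.of_forall fun y => ?_)
    simp [hG'_def, proj_sub]
  · -- the uniform first-order remainder estimate
    intro ε hε
    obtain ⟨δ, hδ, hδε⟩ := Metric.uniformContinuousOn_iff_le.1 hUC ε hε
    have hr : 0 < min δ 1 := lt_min hδ one_pos
    have hmem : S' ∩ ball (t₀, x₀) (min δ 1) ∈ 𝓝[S'] (t₀, x₀) :=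
      inter_mem_nhdsWithin S' (ball_mem_nhds _ hr)
    filter_upwards [hmem] with z hz y
    have hC : Convex ℝ (S' ∩ ball (t₀, x₀) (min δ 1)) :=
      ((convex_Icc a b).prod convex_univ).inter (convex_ball _ _)
    set e : ℝ × EuclideanSpace ℝ d := ((0 : ℝ), reprc y) with he_def
    -- the translated lift and its derivative on the small convex set
    have hderiv : ∀ w ∈ S' ∩ ball (t₀, x₀) (min δ 1),
        HasFDerivWithinAt (fun w => G (w - e)) (G' (w - e)) (S' ∩ ball (t₀, x₀) (min δ 1)) w := by
      intro w hw
      have h1 : HasFDerivWithinAt G (G' (w - e)) S' (w - e) := hGd _ (hmemS' y hw.1)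
      have h2 : HasFDerivWithinAt (fun w : ℝ × EuclideanSpace ℝ d => w - e)
          (ContinuousLinearMap.id ℝ _) (S' ∩ ball (t₀, x₀) (min δ 1)) w :=
        (hasFDerivWithinAt_id w _).sub_const e
      have h3 := h1.comp w h2 (fun w' hw' => hmemS' y hw'.1)
      simpa [Function.comp_def] using h3
    have hbound : ∀ w ∈ S' ∩ ball (t₀, x₀) (min δ 1), ‖G' (w - e) - G' ((t₀, x₀) - e)‖ ≤ ε := by
      intro w hw
      rw [← dist_eq_norm]
      have hw1 : dist w (t₀, x₀) < min δ 1 := mem_ball.1 hw.2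
      refine hδε (w - e) ⟨?_, ?_⟩ ((t₀, x₀) - e) ⟨?_, ?_⟩ ?_
      · rw [hsub1]; exact (mem_prod.1 hw.1).1
      · rw [hsub2, mem_closedBall, dist_eq_norm]
        have h2 : ‖w.2 - x₀‖ ≤ 1 := by
          have := (norm_snd_le (w - (t₀, x₀))).trans (mem_ball_iff_norm.1 hw.2).le
          simpa using this.trans (min_le_right δ 1)
        calc ‖w.2 - reprc y - x₀‖ = ‖(w.2 - x₀) - reprc y‖ := by abel_nf
          _ ≤ ‖w.2 - x₀‖ + ‖reprc y‖ := norm_sub_le _ _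
          _ ≤ 1 + R := add_le_add h2 (hR y)
      · rw [hsub1]; exact ht₀
      · rw [hsub2, mem_closedBall, dist_eq_norm]
        calc ‖x₀ - reprc y - x₀‖ = ‖reprc y‖ := by rw [sub_sub_cancel_left, norm_neg]
          _ ≤ 1 + R := (hR y).trans (by linarith)
      · rw [dist_eq_norm, sub_sub_sub_cancel_right, ← dist_eq_norm]
        exact hw1.le.trans (min_le_left δ 1)
    have key := hC.norm_image_sub_le_of_norm_hasFDerivWithin_le' hderiv hbound
      ⟨hz₀, mem_ball_self hr⟩ hz
    calc ‖θ y • G (z - e) - θ y • G ((t₀, x₀) - e) - (θ y • G' ((t₀, x₀) - e)) (z - (t₀, x₀))‖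
        = ‖θ y‖ * ‖G (z - e) - G ((t₀, x₀) - e) - G' ((t₀, x₀) - e) (z - (t₀, x₀))‖ := by
          simp only [← norm_smul, smul_sub, FunLike.coe_smul, Pi.smul_apply]
      _ ≤ ‖θ y‖ * (ε * ‖z - (t₀, x₀)‖) := mul_le_mul_of_nonneg_left key (norm_nonneg _)
      _ = ε * ‖θ y‖ * ‖z - (t₀, x₀)‖ := by ring

/-- `C^n` regularity of the lift of `t ↦ θ ⋆ g t` on `[a, b] ×ˢ univ` for every `n : ℕ`, `θ ∈ L¹`,
`g` jointly smooth (induction on `n`: the derivative in a fixed direction `p` is the same kind of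
object with `g` replaced by the jointly smooth field `(t, x) ↦ stDeriv [a,b] g t x p`; Mathlib's
`contDiffOn_succ_iff_fderiv_apply`, the codomain staying fixed). [folklore] -/
theorem contDiffOn_stLift_convolution (hθ : Integrable θ volume) (hab : a < b) :
    ∀ (n : ℕ) {g : ℝ → UnitAddTorus d → F}, IsSmoothSpaceTimeOn (Icc a b) g →
      ContDiffOn ℝ n (stLift fun t => θ ⋆ g t) (Icc a b ×ˢ (univ : Set (EuclideanSpace ℝ d)))
  | 0, g, hg => by
    rw [Nat.cast_zero, contDiffOn_zero]
    intro z hz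
    exact (hasFDerivWithinAt_stLift_convolution hθ hg hab hz).continuousWithinAt
  | n + 1, g, hg => by
    have hS : UniqueDiffOn ℝ (Icc a b) := uniqueDiffOn_Icc hab
    have hU : UniqueDiffOn ℝ (Icc a b ×ˢ (univ : Set (EuclideanSpace ℝ d))) :=
      hS.prod uniqueDiffOn_univ
    rw [Nat.cast_succ, contDiffOn_succ_iff_fderiv_apply hU]
    refine ⟨fun z hz => (hasFDerivWithinAt_stLift_convolution hθ hg hab hz).differentiableWithinAt,
      fun h => absurd h (by exact_mod_cast WithTop.coe_ne_top), fun p => ?_⟩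
    have hg' : IsSmoothSpaceTimeOn (Icc a b) (fun t x => stDeriv (Icc a b) g t x p) :=
      (hg.stDeriv hS).clm_comp (ContinuousLinearMap.apply ℝ F p)
    refine (contDiffOn_stLift_convolution hθ hab n hg').congr fun z hz => ?_
    obtain ⟨t, y⟩ := z
    rw [(hasFDerivWithinAt_stLift_convolution hθ hg hab hz).fderivWithin (hU _ hz), stLift_apply,
      stLift_apply, convolution_clm_apply' hθ
        ((hg.stDeriv hS).isSmooth_slice (mem_prod.1 hz).1).continuous]

/-- **Slice-wise mollification of a jointly smooth field is jointly smooth on `[a, b] × T^d`**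
(`θ ∈ L¹(T^d)`, `a < b`; Evans, App. C.4, Thm. 7 (i), parametric and one-sided in time). [folklore] -/
theorem isSmoothSpaceTimeOn_convolution_Icc (hθ : Integrable θ volume) (hab : a < b)
    {g : ℝ → UnitAddTorus d → F} (hg : IsSmoothSpaceTimeOn (Icc a b) g) :
    IsSmoothSpaceTimeOn (Icc a b) (fun t => θ ⋆ g t) :=
  contDiffOn_infty.2 fun n => contDiffOn_stLift_convolution hθ hab n hg

/-- **Slice-wise mollification of a jointly smooth field is jointly smooth**, on every convex time
set with nonempty interior (`[0, T]`, `[0, ∞)`, open intervals, …): localise to compact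
subintervals (`exists_Icc_subset_mem_nhdsWithin_of_convex`) and use the `[a, b]` case.
(Evans, App. C.4, Thm. 7 (i).) [folklore] -/
theorem IsSmoothSpaceTimeOn.convolution {S : Set ℝ} (hθ : Integrable θ volume) (hS : Convex ℝ S)
    (hSi : (interior S).Nonempty) {g : ℝ → UnitAddTorus d → F} (hg : IsSmoothSpaceTimeOn S g) :
    IsSmoothSpaceTimeOn S (fun t => θ ⋆ g t) := by
  intro z hz
  obtain ⟨t₀, x₀⟩ := z
  have ht₀ : t₀ ∈ S := (mem_prod.1 hz).1
  obtain ⟨a', b', hab, hsub, hmem⟩ := exists_Icc_subset_mem_nhdsWithin_of_convex hS hSi ht₀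
  have ht₀' : t₀ ∈ Icc a' b' := mem_of_mem_nhdsWithin ht₀ hmem
  have h := isSmoothSpaceTimeOn_convolution_Icc hθ hab (hg.mono hsub) (t₀, x₀) ⟨ht₀', mem_univ _⟩
  refine h.mono_of_mem_nhdsWithin ?_
  rw [nhdsWithin_prod_eq, nhdsWithin_univ]
  exact prod_mem_prod hmem univ_mem

/-- The one-sided time derivative of the slice-wise mollification on `[a, b]`:
`∂ₜ (θ ⋆ g)(t, x) = (θ ⋆ ∂ₜ g(t, ·))(x)` for `t ∈ [a, b]` (the direction `(1, 0)` of
`hasFDerivWithinAt_stLift_convolution`; Evans, App. C.4, Thm. 7 (i)). [folklore] -/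
theorem timeDerivWithin_convolution_Icc (hθ : Integrable θ volume) (hab : a < b)
    {g : ℝ → UnitAddTorus d → F} (hg : IsSmoothSpaceTimeOn (Icc a b) g) {t : ℝ} (ht : t ∈ Icc a b)
    (x : UnitAddTorus d) :
    timeDerivWithin (Icc a b) (fun t => θ ⋆ g t) t x = (θ ⋆ timeDerivWithin (Icc a b) g t) x := by
  obtain ⟨y, rfl⟩ := proj_surjective x
  have hS : UniqueDiffOn ℝ (Icc a b) := uniqueDiffOn_Icc hab
  have hconv := isSmoothSpaceTimeOn_convolution_Icc hθ hab hg
  rw [hconv.timeDerivWithin_apply_proj hS ht y,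
    (hasFDerivWithinAt_stLift_convolution hθ hg hab ⟨ht, mem_univ y⟩).fderivWithin
      ((hS.prod uniqueDiffOn_univ) _ ⟨ht, mem_univ y⟩),
    stLift_apply, convolution_clm_apply' hθ ((hg.stDeriv hS).isSmooth_slice ht).continuous]
  simp_rw [stDeriv_apply_one_zero]

end Convolution

end Torus

end Literature.Analysis.FunctionSpaces
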